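import Mathlib
import Summits.MatrixMultiplication.MatrixMultiplication.Theses.MatrixPointInterpolation
import Literature.Algebra.PolynomialIdentities.GenericMatricesGrowth
import Summits.MatrixMultiplication.MatrixMultiplication.Theorems.TightWindows.Negative.WindowDimUnbounded

/-!
# `MatrixPointInterpolation.TightWindows` (stmt-MatrixMultiplication-18939) — Negative lane:
# load-bearing hypotheses and the non-uniformity of the threshold

Crux (rank 3, route MatrixPointInterpolation): for every point size `k ≥ 2` and `ε > 0` there is a
threshold `n₁ = n₁(k, ε)` such that every pair `A ∈ M_n(ℂ)²`, `n ≥ n₁`, generating `M_n` by words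
of length `≤ d` (GEN) and masquerading as `M_k` to degree `2d` (MASQ) has window dimension
`wordDim k (2d) := dim span{word-functions of length ≤ 2d on (M_k)²} ≤ n^(2+ε)`.

The conclusion depends on `(k, d)` only, and `wordDim k D ≥ D + 1` is unbounded in `D`
(`succ_le_finrank_wordFun`: the power words `x^m`, `m ≤ D`, are independent functions — evaluate
at scalar pairs and use that a complex polynomial with infinitely many roots vanishes).  Hence
(crux disprover, `Cruxes/TightWindows/Disproof.lean` §(a),(c)):

* `tightWindows_false_without_generation` — drop GEN: the scalar pair `(1,1) ∈ M_n(ℂ)²`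
  masquerades as `M₂` to every degree; `d → ∞` breaks the bound.  GEN is load-bearing.
* `tightWindows_false_without_masquerade` — drop MASQ: the pair (shift `N`, corner unit
  `E_{last,0}`) generates `M_{n}(ℂ)` in degree `2n - 1` (`shiftPair_gen`, `E_{ij} = N^{n-1-i} E N^{j}`)
  and in every larger degree; `d → ∞` breaks the bound.  MASQ is load-bearing.
* `tightWindows_false_without_threshold` — replace `n₁(k,ε) ≤ n` by `2 ≤ n`: at `n = k = 2` the
  matrix units `(E₀₁, E₁₀)` generate `M₂` and masquerade as `M₂` trivially; `wordDim 2 8 ≥ 9 > 2³`.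
  The threshold is load-bearing, and
* `lt_threshold` — quantitatively, ANY `n₁` validating the body at `(k, ε)` has `k < n₁`
  (sizes `n ≤ k` host trivial masquerades to every degree), so
* `tightWindows_false_uniform_threshold` — the natural strengthening "one threshold for all `k`"
  (`∃ n₁ ∀ k`) is FALSE.

What is NOT refuted: the crux.  By the refuter/strategist analysis (crux dir:
`LooseMasquerades.lean`, W.lean) `WindowedKaplansky → TightWindows` and, modulo three textbook
facts of PI-theory, `TightWindows ⟺ WindowedKaplansky`; a counterexample is an infinite family of
(automatically loose) masquerades of a fixed `M_k`, `k ≥ 3` — i.e. a proof of the open sibling crux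
`LongMasquerade`.  No masquerade with `k < n` beyond the automatic range is known.
-/

namespace Summit.MatrixMultiplication.MatrixMultiplication.Theorems

namespace TightWindowsNeg

open Summit.MatrixMultiplication.MatrixMultiplication.Theses.MatrixPointInterpolation

/-! ## (a) Load-bearing hypotheses -/

/-- **The threshold is load-bearing** (and must depend on `k`): without `n₁(k, ε)` the statement
fails at `k = n = 2`, `ε = 1`, `d = 4`, `A = (E₀₁, E₁₀)` — a pair of `2 × 2` matrices masquerades
as `M₂` to every degree, while the window dimension `wordDim 2 8 ≥ 9 > 2³`. [folklore] -/
theorem tightWindows_false_without_threshold :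
    ¬ (∀ k : ℕ, 2 ≤ k → ∀ ε : ℝ, 0 < ε → ∀ (n d : ℕ) (A : Fin 2 → Matrix (Fin n) (Fin n) ℂ), 2 ≤ n →
    Submodule.span ℂ {M : Matrix (Fin n) (Fin n) ℂ |
      ∃ w : List (Fin 2), w.length ≤ d ∧ (w.map A).prod = M} = ⊤ →
    (∀ (T : Finset (List (Fin 2))) (c : List (Fin 2) → ℂ), (∀ w ∈ T, w.length ≤ 2 * d) →
      (∀ B : Fin 2 → Matrix (Fin k) (Fin k) ℂ, (∑ w ∈ T, c w • (w.map B).prod) = 0) →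
      (∑ w ∈ T, c w • (w.map A).prod) = 0) →
    (Module.finrank ℂ (Submodule.span ℂ
      {f : (Fin 2 → Matrix (Fin k) (Fin k) ℂ) → Matrix (Fin k) (Fin k) ℂ |
        ∃ w : List (Fin 2), w.length ≤ 2 * d ∧ f = fun B => (w.map B).prod}) : ℝ) ≤
      (n : ℝ) ^ ((2 : ℝ) + ε)) := by
  intro h
  have hB := h 2 le_rfl 1 one_pos 2 4 (![Matrix.single 0 1 1, Matrix.single 1 0 1] : Fin 2 → Matrix (Fin 2) (Fin 2) ℂ) le_rfl
    (unitPair_gen (by norm_num)) (masq_self _)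
  have h9 := succ_le_finrank_wordFun 2 (2 * 4) two_pos
  have h9' : ((2 * 4 + 1 : ℕ) : ℝ) ≤ ((2 : ℕ) : ℝ) ^ ((2 : ℝ) + 1) :=
    le_trans (by exact_mod_cast h9) hB
  have h8 : ((2 : ℕ) : ℝ) ^ ((2 : ℝ) + 1) = 8 := by
    rw [show (2 : ℝ) + 1 = ((3 : ℕ) : ℝ) by norm_num, Real.rpow_natCast]; norm_num
  rw [h8] at h9'
  norm_num at h9'

/-- Quantitative form: at point size `k = 2`, ANY threshold `n₁` validating the body of
`TightWindows` (for any real `ε`) satisfies `3 ≤ n₁` — the sizes `n ≤ k` must be excluded, since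
there every generating pair is a masquerade to every degree and the window dimension is unbounded
in `d`. [folklore] -/
theorem three_le_threshold_two (ε : ℝ) (n₁ : ℕ)
    (h : ∀ (n d : ℕ) (A : Fin 2 → Matrix (Fin n) (Fin n) ℂ), n₁ ≤ n →
      Submodule.span ℂ {M : Matrix (Fin n) (Fin n) ℂ |
        ∃ w : List (Fin 2), w.length ≤ d ∧ (w.map A).prod = M} = ⊤ →
      (∀ (T : Finset (List (Fin 2))) (c : List (Fin 2) → ℂ), (∀ w ∈ T, w.length ≤ 2 * d) →
        (∀ B : Fin 2 → Matrix (Fin 2) (Fin 2) ℂ, (∑ w ∈ T, c w • (w.map B).prod) = 0) →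
        (∑ w ∈ T, c w • (w.map A).prod) = 0) →
      (Module.finrank ℂ (Submodule.span ℂ
        {f : (Fin 2 → Matrix (Fin 2) (Fin 2) ℂ) → Matrix (Fin 2) (Fin 2) ℂ |
          ∃ w : List (Fin 2), w.length ≤ 2 * d ∧ f = fun B => (w.map B).prod}) : ℝ) ≤
        (n : ℝ) ^ ((2 : ℝ) + ε)) :
    3 ≤ n₁ := by
  by_contra hlt
  push Not at hlt
  set d : ℕ := ⌈(2 : ℝ) ^ ((2 : ℝ) + ε)⌉₊ + 2 with hd
  have hB := h 2 d (![Matrix.single 0 1 1, Matrix.single 1 0 1] : Fin 2 → Matrix (Fin 2) (Fin 2) ℂ) (by omega)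
    (unitPair_gen (by omega)) (masq_self _)
  have hfr := succ_le_finrank_wordFun 2 (2 * d) two_pos
  have h1 : ((2 * d + 1 : ℕ) : ℝ) ≤ ((2 : ℕ) : ℝ) ^ ((2 : ℝ) + ε) :=
    le_trans (by exact_mod_cast hfr) hB
  have h2 : (2 : ℝ) ^ ((2 : ℝ) + ε) ≤ (⌈(2 : ℝ) ^ ((2 : ℝ) + ε)⌉₊ : ℝ) := Nat.le_ceil _
  rw [hd] at h1
  push_cast at h1
  linarith

/-- **Generation is load-bearing**: the scalar pair `(1, 1) ∈ M_n(ℂ)²` masquerades as `M₂` to every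
degree (it generates only the scalars), while `wordDim 2 (2d) ≥ 2d + 1` is unbounded in `d`; at
`ε = 1`, `d = n³` the bound `≤ n³` fails for every `n`. [folklore] -/
theorem tightWindows_false_without_generation :
    ¬ (∀ k : ℕ, 2 ≤ k → ∀ ε : ℝ, 0 < ε → ∃ n₁ : ℕ, ∀ (n d : ℕ) (A : Fin 2 → Matrix (Fin n) (Fin n) ℂ),
    n₁ ≤ n →
    (∀ (T : Finset (List (Fin 2))) (c : List (Fin 2) → ℂ), (∀ w ∈ T, w.length ≤ 2 * d) →
      (∀ B : Fin 2 → Matrix (Fin k) (Fin k) ℂ, (∑ w ∈ T, c w • (w.map B).prod) = 0) →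
      (∑ w ∈ T, c w • (w.map A).prod) = 0) →
    (Module.finrank ℂ (Submodule.span ℂ
      {f : (Fin 2 → Matrix (Fin k) (Fin k) ℂ) → Matrix (Fin k) (Fin k) ℂ |
        ∃ w : List (Fin 2), w.length ≤ 2 * d ∧ f = fun B => (w.map B).prod}) : ℝ) ≤
      (n : ℝ) ^ ((2 : ℝ) + ε)) := by
  intro h
  obtain ⟨n₁, hn₁⟩ := h 2 le_rfl 1 one_pos
  have hb := hn₁ (n₁ + 2) ((n₁ + 2) ^ 3) (fun _ => 1) (by omega) (masq_one two_pos)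
  have hfr := succ_le_finrank_wordFun 2 (2 * (n₁ + 2) ^ 3) two_pos
  have hcast : (((n₁ + 2 : ℕ) : ℝ)) ^ ((2 : ℝ) + 1) = (((n₁ + 2) ^ 3 : ℕ) : ℝ) := by
    rw [show (2 : ℝ) + 1 = ((3 : ℕ) : ℝ) by norm_num, Real.rpow_natCast]; push_cast; ring
  rw [hcast] at hb
  have h1 : ((2 * (n₁ + 2) ^ 3 + 1 : ℕ) : ℝ) ≤ (((n₁ + 2) ^ 3 : ℕ) : ℝ) :=
    le_trans (by exact_mod_cast hfr) hb
  have h2 : 2 * (n₁ + 2) ^ 3 + 1 ≤ (n₁ + 2) ^ 3 := by exact_mod_cast h1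
  omega

/-- **The masquerade hypothesis is load-bearing**: a fixed generating pair of `M_n(ℂ)` keeps
generating in every larger degree `d`, while `wordDim 2 (2d)` is unbounded in `d`. [folklore] -/
theorem tightWindows_false_without_masquerade :
    ¬ (∀ k : ℕ, 2 ≤ k → ∀ ε : ℝ, 0 < ε → ∃ n₁ : ℕ, ∀ (n d : ℕ) (A : Fin 2 → Matrix (Fin n) (Fin n) ℂ),
    n₁ ≤ n →
    Submodule.span ℂ {M : Matrix (Fin n) (Fin n) ℂ |
      ∃ w : List (Fin 2), w.length ≤ d ∧ (w.map A).prod = M} = ⊤ →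
    (Module.finrank ℂ (Submodule.span ℂ
      {f : (Fin 2 → Matrix (Fin k) (Fin k) ℂ) → Matrix (Fin k) (Fin k) ℂ |
        ∃ w : List (Fin 2), w.length ≤ 2 * d ∧ f = fun B => (w.map B).prod}) : ℝ) ≤
      (n : ℝ) ^ ((2 : ℝ) + ε)) := by
  intro h
  obtain ⟨n₁, hn₁⟩ := h 2 le_rfl 1 one_pos
  set d : ℕ := 2 * n₁ + 1 + (n₁ + 1) ^ 3 with hd
  have hb := hn₁ (n₁ + 1) d
    (![Matrix.of fun i j : Fin (n₁ + 1) => if (j : ℕ) = (i : ℕ) + 1 then (1 : ℂ) else 0,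
      Matrix.single (Fin.last n₁) 0 1] : Fin 2 → Matrix (Fin (n₁ + 1)) (Fin (n₁ + 1)) ℂ)
    (by omega) (shiftPair_gen _ (fun _ _ => rfl) (by omega))
  have hfr := succ_le_finrank_wordFun 2 (2 * d) two_pos
  have hcast : (((n₁ + 1 : ℕ) : ℝ)) ^ ((2 : ℝ) + 1) = (((n₁ + 1) ^ 3 : ℕ) : ℝ) := by
    rw [show (2 : ℝ) + 1 = ((3 : ℕ) : ℝ) by norm_num, Real.rpow_natCast]; push_cast; ring
  rw [hcast] at hb
  have h1 : ((2 * d + 1 : ℕ) : ℝ) ≤ (((n₁ + 1) ^ 3 : ℕ) : ℝ) := le_trans (by exact_mod_cast hfr) hb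
  have h2 : 2 * d + 1 ≤ (n₁ + 1) ^ 3 := by exact_mod_cast h1
  omega

/-! ## (c) A natural strengthening refuted: the threshold cannot be uniform in `k` -/

/-- **No threshold uniform in `k`**: given `n₁`, take `k = n = n₁ + 1` and a generating pair of
`M_n(ℂ)` — it masquerades as `M_k = M_n` to every degree — and let `d → ∞`. So `n₁(k, ε) > k`
necessarily (`lt_threshold`). [folklore] -/
theorem tightWindows_false_uniform_threshold :
    ¬ (∀ ε : ℝ, 0 < ε → ∃ n₁ : ℕ, ∀ k : ℕ, 2 ≤ k → ∀ (n d : ℕ) (A : Fin 2 → Matrix (Fin n) (Fin n) ℂ),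
    n₁ ≤ n →
    Submodule.span ℂ {M : Matrix (Fin n) (Fin n) ℂ |
      ∃ w : List (Fin 2), w.length ≤ d ∧ (w.map A).prod = M} = ⊤ →
    (∀ (T : Finset (List (Fin 2))) (c : List (Fin 2) → ℂ), (∀ w ∈ T, w.length ≤ 2 * d) →
      (∀ B : Fin 2 → Matrix (Fin k) (Fin k) ℂ, (∑ w ∈ T, c w • (w.map B).prod) = 0) →
      (∑ w ∈ T, c w • (w.map A).prod) = 0) →
    (Module.finrank ℂ (Submodule.span ℂ
      {f : (Fin 2 → Matrix (Fin k) (Fin k) ℂ) → Matrix (Fin k) (Fin k) ℂ |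
        ∃ w : List (Fin 2), w.length ≤ 2 * d ∧ f = fun B => (w.map B).prod}) : ℝ) ≤
      (n : ℝ) ^ ((2 : ℝ) + ε)) := by
  intro h
  obtain ⟨n₁, hn₁⟩ := h 1 one_pos
  set d : ℕ := 2 * (n₁ + 1) + 1 + (n₁ + 2) ^ 3 with hd
  have hb := hn₁ (n₁ + 2) (by omega) (n₁ + 2) d
    (![Matrix.of fun i j : Fin (n₁ + 1 + 1) => if (j : ℕ) = (i : ℕ) + 1 then (1 : ℂ) else 0,
      Matrix.single (Fin.last (n₁ + 1)) 0 1] : Fin 2 → Matrix (Fin (n₁ + 1 + 1)) (Fin (n₁ + 1 + 1)) ℂ)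
    (by omega) (shiftPair_gen _ (fun _ _ => rfl) (by omega)) (masq_self _)
  have hfr := succ_le_finrank_wordFun (n₁ + 2) (2 * d) (by omega)
  have hcast : (((n₁ + 2 : ℕ) : ℝ)) ^ ((2 : ℝ) + 1) = (((n₁ + 2) ^ 3 : ℕ) : ℝ) := by
    rw [show (2 : ℝ) + 1 = ((3 : ℕ) : ℝ) by norm_num, Real.rpow_natCast]; push_cast; ring
  rw [hcast] at hb
  have h1 : ((2 * d + 1 : ℕ) : ℝ) ≤ (((n₁ + 2) ^ 3 : ℕ) : ℝ) := le_trans (by exact_mod_cast hfr) hb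
  have h2 : 2 * d + 1 ≤ (n₁ + 2) ^ 3 := by exact_mod_cast h1
  omega

/-- **Any valid threshold exceeds the point size**: if `n₁` validates the body of `TightWindows` at
`(k, ε)` (any real `ε`), then `k < n₁`.  (At `n = k` every generating pair is a masquerade to
every degree and `wordDim k (2d) ≥ 2d + 1 → ∞`.)  Together with the refuter's automatic range this
is the first constraint a proof must respect: the threshold is a genuine function of `k`.
[folklore] -/
theorem lt_threshold (k : ℕ) (hk : 2 ≤ k) (ε : ℝ) (n₁ : ℕ)
    (h : ∀ (n d : ℕ) (A : Fin 2 → Matrix (Fin n) (Fin n) ℂ), n₁ ≤ n →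
      Submodule.span ℂ {M : Matrix (Fin n) (Fin n) ℂ |
        ∃ w : List (Fin 2), w.length ≤ d ∧ (w.map A).prod = M} = ⊤ →
      (∀ (T : Finset (List (Fin 2))) (c : List (Fin 2) → ℂ), (∀ w ∈ T, w.length ≤ 2 * d) →
        (∀ B : Fin 2 → Matrix (Fin k) (Fin k) ℂ, (∑ w ∈ T, c w • (w.map B).prod) = 0) →
        (∑ w ∈ T, c w • (w.map A).prod) = 0) →
      (Module.finrank ℂ (Submodule.span ℂ
        {f : (Fin 2 → Matrix (Fin k) (Fin k) ℂ) → Matrix (Fin k) (Fin k) ℂ |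
          ∃ w : List (Fin 2), w.length ≤ 2 * d ∧ f = fun B => (w.map B).prod}) : ℝ) ≤
        (n : ℝ) ^ ((2 : ℝ) + ε)) :
    k < n₁ := by
  by_contra hle
  push Not at hle
  obtain ⟨m, rfl⟩ : ∃ m, k = m + 1 := ⟨k - 1, by omega⟩
  set d : ℕ := 2 * m + 1 + ⌈((m + 1 : ℕ) : ℝ) ^ ((2 : ℝ) + ε)⌉₊ with hd
  have hb := h (m + 1) d
    (![Matrix.of fun i j : Fin (m + 1) => if (j : ℕ) = (i : ℕ) + 1 then (1 : ℂ) else 0,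
      Matrix.single (Fin.last m) 0 1] : Fin 2 → Matrix (Fin (m + 1)) (Fin (m + 1)) ℂ)
    hle (shiftPair_gen _ (fun _ _ => rfl) (by omega)) (masq_self _)
  have hfr := succ_le_finrank_wordFun (m + 1) (2 * d) (by omega)
  have h1 : ((2 * d + 1 : ℕ) : ℝ) ≤ ((m + 1 : ℕ) : ℝ) ^ ((2 : ℝ) + ε) :=
    le_trans (by exact_mod_cast hfr) hb
  have h2 : ((m + 1 : ℕ) : ℝ) ^ ((2 : ℝ) + ε) ≤ (⌈((m + 1 : ℕ) : ℝ) ^ ((2 : ℝ) + ε)⌉₊ : ℝ) :=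
    Nat.le_ceil _
  rw [hd] at h1
  push_cast at h1 h2
  linarith

end TightWindowsNeg

end Summit.MatrixMultiplication.MatrixMultiplication.Theorems
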